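import Literature.NumberTheory.LFunctions.LehmanCriticalLineBoundProofs
import Literature.Analysis.SpecialFunctions.GammaVerticalBounds
import Mathlib.NumberTheory.Harmonic.Bounds
import HarnessLib

/-!
# `|ζ(1+it)| ≤ ½ log t + 1.85` for `t ≥ 128π`, from the Riemann–Siegel integral formula

Topic `Literature/NumberTheory/LFunctions`.  An explicit bound for `ζ` on the line `σ = 1`, PROVED
(no named facts), of the quality needed by Turing's method II
(`TuringMethodTrudgianIILehman.lean`: any bound `|ζ(1+it)| ≤ ½ log t + C`, `C ≤ 1.93`, for
`t ≳ 400` closes Trudgian's Theorem 1): for `t ≥ 128π`,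
`|ζ(1+it)| ≤ ½ log t + 1.85` (`SiegelIntegral.norm_riemannZeta_one_add_le_half_log`).

This is the "trivial" treatment of the Riemann–Siegel formula on `σ = 1` (Patel, Indag. Math. 33
(2022), eq. (4.1): `½ log t + 1.93` for `t ≥ 47`, with Arias de Reyna's remainder bounds; Hoo–Teo,
arXiv:2412.00766: `½ log t + 0.6633`), run on the tree's form of Riemann's integral formula
(`RiemannSiegelIntegralFormula.lean`, Siegel 1932 §3):
`ζ(s) = 𝓡(s) + χ(s) conj 𝓡(1 − s̄)`
(`Literature.NumberTheory.LFunctions.SiegelIntegral.riemannZeta_eq_riemannAux_add`, `0 < σ < 3`), the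
residue shift `𝓡(w) = Σ_{n≤N} n^{-w} + J_c(w)`
(`Literature.NumberTheory.LFunctions.SiegelIntegral.riemannAux_eq_sum_add_rsLineIntegral`, any `w`), and
the crude saddle-point majorants of `LehmanCriticalLineBoundProofs.lean` (Titchmarsh §4.16), here
extended from `σ = ½` to general `σ` with a bound `P` for the power `‖x‖^{-σ}`:

* `norm_rsKernel_line_eq` — `‖F_s(c + u(1+i))‖ = ‖x‖^{-σ} e^{t arg x − 2πcu − 2πu²}/(2‖sin πx‖)`;
* `norm_rsKernel_core_of_le`, `_mid_of_le`, `_tail_of_le`, `integral_norm_rsKernel_le_of_le` —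
  for `Im s = t = 2πx₀²`, `x₀ ≥ 8`, the saddle line through the clamped `c`:
  `∫ ‖F_s‖ du ≤ P₁(25/28 + 3/(2π)) + P₂ (44/9)(0.0838)` if `‖x‖^{-σ} ≤ P₁` (`|u| ≤ ½`), `≤ P₂`
  (`|u| > ½`);
* `integral_norm_rsKernel_one_le` (`σ = 1`: `P₁ = 4/29`, `P₂ = 0.1826`, total `≤ 0.264`),
  `integral_norm_rsKernel_zero_le` (`σ = 0`: `P = 1`, total `≤ 1.781`);
* `norm_rsChi_one_add_le` — `|χ(1+it)| ≤ 1.0001 √(2π/t)` for `t ≥ 4` (`|χ(1+it)|² = (2π/t)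
  coth(πt/2)` from `|Γ(1+it)|² = πt/sinh(πt)`,
  `Literature.Analysis.SpecialFunctions.GammaVert.norm_sq_Gamma_one`);
* `norm_riemannZeta_one_add_le_half_log` — the assembly at `s = 1 + it`, `K(s) = conj 𝓡(it)`:
  `|ζ(1+it)| ≤ (1 + log N) + √2·0.264 + 1.0001 x₀⁻¹ (N + √2·1.781) ≤ ½ log t + 1.85`
  (`N = ⌊x₀⌋`, `x₀ = √(t/2π) ≥ 8`, `H_N ≤ 1 + log N`, `log(2π) ≥ 1.7195`).

## References

* D. Patel, *An explicit upper bound for `|ζ(1+it)|`*, Indag. Math. 33 (2022), 1012–1032, Thm 1.1,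
  (4.1).  [Patel2022]
* E. Q. Hoo, L.-P. Teo, *Explicit bound of `|ζ(1+it)|`*, arXiv:2412.00766 (2024).  [HooTeo2024]
* C. L. Siegel, *Über Riemanns Nachlaß zur analytischen Zahlentheorie* (1932), §2–3.  [Siegel1932]
* E. C. Titchmarsh, *The Theory of the Riemann Zeta-Function*, 2nd ed. (1986), §4.16, (4.12.3).
  [Titchmarsh1986]
-/

noncomputable section

open Complex MeasureTheory Set Filter Real
open scoped Topology ComplexConjugate

namespace Literature.NumberTheory.LFunctions

namespace SiegelIntegral

/-! ### The modulus of Siegel's integrand on the saddle line, general `s` -/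

/-- For `s = σ + it` and `x = c + u(1+i)` (`c > 0`):
`‖F_s(x)‖ = ‖x‖^{-σ} e^{t·arg x − 2πcu − 2πu²}/(2‖sin πx‖)`. [folklore] -/
lemma norm_rsKernel_line_eq {c : ℝ} (hc : 0 < c) (s : ℂ) (u : ℝ) :
    ‖rsKernel s (line c u)‖ =
      ‖line c u‖ ^ (-s.re) * Real.exp (s.im * (line c u).arg + (-2 * π * c * u - 2 * π * u ^ 2)) /
        (2 * ‖Complex.sin (π * line c u)‖) := by
  have hx : line c u ≠ 0 := line_ne_zero hc.ne' u
  rw [rsKernel, norm_div, norm_mul, norm_mul, norm_mul, Complex.norm_two, Complex.norm_I, mul_one,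
    norm_cpow_neg hx]
  have h2 : ‖cexp (π * I * (line c u) ^ 2)‖ = Real.exp (-2 * π * c * u - 2 * π * u ^ 2) := by
    have := norm_cexp_quadPhase 0 c u
    simp only [zero_mul, add_zero, zero_re, zero_im, sub_zero] at this
    rw [this]; congr 1; ring
  rw [h2, Real.exp_add]
  ring

/-! ### Pointwise bounds on the three ranges, with a bound `P` for the power `‖x‖^{-σ}` -/

/-- **Core range** `|u| ≤ ¼` (`t = Im s = 2πx₀²`, `x₀ ≥ 8`, `|c − x₀| ≤ ¼`, `dist(c,ℤ) ≥ ¼`): if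
`‖x‖^{-σ} ≤ P` then `‖F_s(x)‖ ≤ P · 25/14` (exponent `≤ 2/5`, `‖sin‖ ≥ 21/50`).
[cite: Titchmarsh1986, §4.16] -/
lemma norm_rsKernel_core_of_le {x₀ c u P : ℝ} {s : ℂ} (ht : s.im = 2 * π * x₀ ^ 2) (hx₀ : 8 ≤ x₀)
    (hδ : |c - x₀| ≤ 1 / 4) (hd : ∀ n : ℤ, (1 : ℝ) / 4 ≤ |c - n|) (hu : |u| ≤ 1 / 4)
    (hP0 : 0 ≤ P) (hP : ‖line c u‖ ^ (-s.re) ≤ P) :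
    ‖rsKernel s (line c u)‖ ≤ P * (25 / 14) := by
  obtain ⟨hδ1, hδ2⟩ := abs_le.1 hδ
  have hc0 : 0 < c := by linarith
  rw [norm_rsKernel_line_eq hc0, ht]
  have hE : Real.exp (2 * π * x₀ ^ 2 * (line c u).arg + (-2 * π * c * u - 2 * π * u ^ 2)) ≤ 3 / 2 :=
    (Real.exp_le_exp.2 (exponent_le_two_fifths hx₀ hδ (by linarith [abs_nonneg u]))).trans
      exp_two_fifths_le.1
  have hS := norm_sin_core hd hu
  have hnum : ‖line c u‖ ^ (-s.re) *
      Real.exp (2 * π * x₀ ^ 2 * (line c u).arg + (-2 * π * c * u - 2 * π * u ^ 2)) ≤ P * (3 / 2) :=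
    mul_le_mul hP hE (Real.exp_pos _).le hP0
  calc _ ≤ P * (3 / 2) / (2 * ‖Complex.sin (↑π * line c u)‖) :=
        div_le_div_of_nonneg_right hnum (by positivity)
    _ ≤ P * (3 / 2) / (2 * (21 / 50)) :=
        div_le_div_of_nonneg_left (by positivity) (by norm_num) (by linarith)
    _ = P * (25 / 14) := by ring

/-- **Middle range** `¼ ≤ |u| ≤ ½`: if `‖x‖^{-σ} ≤ P` then `‖F_s(x)‖ ≤ P · 3/π` (exponent `≤ 2/5`,
`‖sin‖ ≥ π|u| ≥ π/4`). [cite: Titchmarsh1986, §4.16] -/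
lemma norm_rsKernel_mid_of_le {x₀ c u P : ℝ} {s : ℂ} (ht : s.im = 2 * π * x₀ ^ 2) (hx₀ : 8 ≤ x₀)
    (hδ : |c - x₀| ≤ 1 / 4) (hu1 : (1 : ℝ) / 4 ≤ |u|) (hu2 : |u| ≤ 1 / 2)
    (hP0 : 0 ≤ P) (hP : ‖line c u‖ ^ (-s.re) ≤ P) :
    ‖rsKernel s (line c u)‖ ≤ P * (3 / π) := by
  have hπ := Real.pi_pos
  obtain ⟨hδ1, hδ2⟩ := abs_le.1 hδ
  have hc0 : 0 < c := by linarith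
  rw [norm_rsKernel_line_eq hc0, ht]
  have hE : Real.exp (2 * π * x₀ ^ 2 * (line c u).arg + (-2 * π * c * u - 2 * π * u ^ 2)) ≤ 3 / 2 :=
    (Real.exp_le_exp.2 (exponent_le_two_fifths hx₀ hδ hu2)).trans exp_two_fifths_le.1
  have hS : π / 4 ≤ ‖Complex.sin (π * line c u)‖ := by
    have := pi_mul_abs_le_norm_sin c u
    nlinarith [Real.pi_pos]
  have hnum : ‖line c u‖ ^ (-s.re) *
      Real.exp (2 * π * x₀ ^ 2 * (line c u).arg + (-2 * π * c * u - 2 * π * u ^ 2)) ≤ P * (3 / 2) :=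
    mul_le_mul hP hE (Real.exp_pos _).le hP0
  calc _ ≤ P * (3 / 2) / (2 * ‖Complex.sin (↑π * line c u)‖) :=
        div_le_div_of_nonneg_right hnum (by positivity)
    _ ≤ P * (3 / 2) / (2 * (π / 4)) :=
        div_le_div_of_nonneg_left (by positivity) (by positivity) (by linarith)
    _ = P * (3 / π) := by field_simp; ring

/-- **Tail range** `|u| > ½`: if `‖x‖^{-σ} ≤ P` then `‖F_s(x)‖ ≤ P · (22/9) e^{−π|u|}` (exponent
`≤ 1/5`, `‖sin‖ ≥ e^{π|u|}/4`). [cite: Titchmarsh1986, §4.16] -/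
lemma norm_rsKernel_tail_of_le {x₀ c u P : ℝ} {s : ℂ} (ht : s.im = 2 * π * x₀ ^ 2) (hx₀ : 8 ≤ x₀)
    (hδ : |c - x₀| ≤ 1 / 4) (hu : (1 : ℝ) / 2 < |u|) (hP0 : 0 ≤ P) (hP : ‖line c u‖ ^ (-s.re) ≤ P) :
    ‖rsKernel s (line c u)‖ ≤ P * (22 / 9) * Real.exp (-(π * |u|)) := by
  obtain ⟨hδ1, hδ2⟩ := abs_le.1 hδ
  have hc0 : 0 < c := by linarith
  rw [norm_rsKernel_line_eq hc0, ht]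
  have hE : Real.exp (2 * π * x₀ ^ 2 * (line c u).arg + (-2 * π * c * u - 2 * π * u ^ 2)) ≤ 11 / 9 :=
    (Real.exp_le_exp.2 (exponent_le_one_fifth hx₀ hδ hu.le)).trans exp_two_fifths_le.2
  have hS := exp_le_norm_sin_tail c hu.le
  have hexp0 : 0 < Real.exp (π * |u|) := Real.exp_pos _
  have hnum : ‖line c u‖ ^ (-s.re) *
      Real.exp (2 * π * x₀ ^ 2 * (line c u).arg + (-2 * π * c * u - 2 * π * u ^ 2)) ≤ P * (11 / 9) :=
    mul_le_mul hP hE (Real.exp_pos _).le hP0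
  calc _ ≤ P * (11 / 9) / (2 * ‖Complex.sin (↑π * line c u)‖) :=
        div_le_div_of_nonneg_right hnum (by positivity)
    _ ≤ P * (11 / 9) / (2 * (Real.exp (π * |u|) / 4)) :=
        div_le_div_of_nonneg_left (by positivity) (by positivity) (by linarith)
    _ = P * (22 / 9) * Real.exp (-(π * |u|)) := by
        rw [Real.exp_neg]
        field_simp
        ring

/-! ### The integral of `‖F_s‖` along the saddle line, with power bounds `P₁` (`|u| ≤ ½`), `P₂` -/

/-- **The saddle-point bound for general `s`** (crude form of Titchmarsh §4.16 / Siegel §2): for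
`Im s = 2πx₀²`, `x₀ ≥ 8`, `|c − x₀| ≤ ¼`, `dist(c, ℤ) ≥ ¼`, if `‖x‖^{-σ} ≤ P₁` for `|u| ≤ ½` and
`‖x‖^{-σ} ≤ P₂` for `|u| > ½` along `x = c + u(1+i)`, then
`∫ ‖F_s(c + u(1+i))‖ du ≤ P₁ (25/28 + 3/(2π)) + P₂ (44/9) · 0.0838`
(core `½·(25/14)P₁`, middle `2·¼·(3/π)P₁`, tails `2·(22/9)P₂ e^{−π/2}/π`, `e^{−π/2}/π ≤ 0.0838`).
[cite: Titchmarsh1986, §4.16] -/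
theorem integral_norm_rsKernel_le_of_le {x₀ c P₁ P₂ : ℝ} {s : ℂ} (ht : s.im = 2 * π * x₀ ^ 2)
    (hx₀ : 8 ≤ x₀) (hδ : |c - x₀| ≤ 1 / 4) (hd : ∀ n : ℤ, (1 : ℝ) / 4 ≤ |c - n|)
    (hP₁0 : 0 ≤ P₁) (hP₂0 : 0 ≤ P₂)
    (hP₁ : ∀ u : ℝ, |u| ≤ 1 / 2 → ‖line c u‖ ^ (-s.re) ≤ P₁)
    (hP₂ : ∀ u : ℝ, 1 / 2 < |u| → ‖line c u‖ ^ (-s.re) ≤ P₂) :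
    ∫ u : ℝ, ‖rsKernel s (line c u)‖ ≤ P₁ * (25 / 28 + 3 / (2 * π)) + P₂ * (44 / 9) * 0.0838 := by
  have hπ := Real.pi_pos
  have hπ3 : 3.1415 < π := Real.pi_gt_d4
  obtain ⟨hδ1, hδ2⟩ := abs_le.1 hδ
  have hc0 : 0 < c := by linarith
  set g : ℝ → ℝ := fun u ↦ ‖rsKernel s (line c u)‖ with hg
  have hgi : Integrable g := (integrable_rsKernel_line s hc0 (by norm_num : (0 : ℝ) < 1 / 4) hd).norm
  have hg0 : ∀ u, 0 ≤ g u := fun u ↦ norm_nonneg _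
  have hmid : ∀ (a b : ℝ) (M : ℝ), a ≤ b → (∀ u ∈ Ioc a b, g u ≤ M) →
      ∫ u in Ioc a b, g u ≤ M * (b - a) := by
    intro a b M hab hM
    have h1 : ∫ u in Ioc a b, g u ≤ ∫ _ in Ioc a b, M := by
      refine integral_mono_of_nonneg ?_
        ((continuous_const.integrableOn_Icc (a := a) (b := b)).mono_set Set.Ioc_subset_Icc_self) ?_
      · exact Eventually.of_forall fun u ↦ hg0 u
      · exact (ae_restrict_iff' measurableSet_Ioc).2 (Eventually.of_forall hM)
    rw [setIntegral_const, Real.volume_real_Ioc_of_le hab, smul_eq_mul] at h1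
    linarith
  have htail : ∀ f : ℝ → ℝ, (∀ u, 0 ≤ f u) →
      (∀ u ∈ Ioi (1 / 2 : ℝ), f u ≤ P₂ * (22 / 9) * Real.exp (-(π * u))) →
      ∫ u in Ioi (1 / 2 : ℝ), f u ≤ P₂ * (22 / 9) * (Real.exp (-(π * (1 / 2))) / π) := by
    intro f hf0 hf
    have hexpi : IntegrableOn (fun u : ℝ ↦ P₂ * (22 / 9) * Real.exp (-π * u)) (Ioi (1 / 2)) :=
      (integrableOn_exp_mul_Ioi (by linarith) _).const_mul _
    have h1 : ∫ u in Ioi (1 / 2 : ℝ), f u ≤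
        ∫ u in Ioi (1 / 2 : ℝ), P₂ * (22 / 9) * Real.exp (-π * u) := by
      refine integral_mono_of_nonneg (Eventually.of_forall fun u ↦ hf0 u) hexpi ?_
      refine (ae_restrict_iff' measurableSet_Ioi).2 (Eventually.of_forall fun u hu ↦ ?_)
      show f u ≤ P₂ * (22 / 9) * Real.exp (-π * u)
      rw [neg_mul]; exact hf u hu
    rw [MeasureTheory.integral_const_mul, integral_exp_mul_Ioi (by linarith) (1 / 2)] at h1
    rw [neg_mul] at h1
    have e : -Real.exp (-(π * (1 / 2))) / -π = Real.exp (-(π * (1 / 2))) / π := by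
      rw [neg_div_neg_eq]
    rwa [e] at h1
  have hsplit1 := (intervalIntegral.integral_Iic_add_Ioi (b := -(1 / 2 : ℝ)) hgi.integrableOn
    hgi.integrableOn).symm
  have hunion : ∀ a b : ℝ, a ≤ b → ∫ u in Ioi a, g u = (∫ u in Ioc a b, g u) + ∫ u in Ioi b, g u := by
    intro a b hab
    rw [← setIntegral_union Set.Ioc_disjoint_Ioi_same measurableSet_Ioi hgi.integrableOn
      hgi.integrableOn, Set.Ioc_union_Ioi_eq_Ioi hab]
  have hleft : ∫ u in Iic (-(1 / 2 : ℝ)), g u ≤ P₂ * (22 / 9) * (Real.exp (-(π * (1 / 2))) / π) := by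
    rw [← integral_comp_neg_Ioi]
    · refine htail (fun u ↦ g (-u)) (fun u ↦ hg0 _) fun u hu ↦ ?_
      have hu0 : (0 : ℝ) < u := by linarith [hu.out]
      have hu' : (1 : ℝ) / 2 < |(-u)| := by rw [abs_neg, abs_of_pos hu0]; exact hu
      have h := norm_rsKernel_tail_of_le (u := -u) ht hx₀ hδ hu' hP₂0 (hP₂ _ hu')
      rw [abs_neg, abs_of_pos hu0] at h
      exact h
  have hright : ∫ u in Ioi (1 / 2 : ℝ), g u ≤ P₂ * (22 / 9) * (Real.exp (-(π * (1 / 2))) / π) := by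
    refine htail g hg0 fun u hu ↦ ?_
    have hu0 : (0 : ℝ) < u := by linarith [hu.out]
    have hu' : (1 : ℝ) / 2 < |u| := by rw [abs_of_pos hu0]; exact hu
    have h := norm_rsKernel_tail_of_le (u := u) ht hx₀ hδ hu' hP₂0 (hP₂ _ hu')
    rw [abs_of_pos hu0] at h
    exact h
  have hm1 : ∫ u in Ioc (-(1 / 2 : ℝ)) (-(1 / 4)), g u ≤ P₁ * (3 / π) * (-(1 / 4) - -(1 / 2 : ℝ)) :=
    hmid _ _ _ (by norm_num) fun u hu ↦ by
      have h1 : (1 : ℝ) / 4 ≤ |u| := by rw [abs_of_neg (by linarith [hu.2])]; linarith [hu.2]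
      have h2 : |u| ≤ 1 / 2 := by rw [abs_of_neg (by linarith [hu.2])]; linarith [hu.1]
      exact norm_rsKernel_mid_of_le ht hx₀ hδ h1 h2 hP₁0 (hP₁ u h2)
  have hm2 : ∫ u in Ioc (-(1 / 4 : ℝ)) (1 / 4), g u ≤ P₁ * (25 / 14) * (1 / 4 - -(1 / 4 : ℝ)) :=
    hmid _ _ _ (by norm_num) fun u hu ↦ by
      have h1 : |u| ≤ 1 / 4 := abs_le.2 ⟨hu.1.le, hu.2⟩
      exact norm_rsKernel_core_of_le ht hx₀ hδ hd h1 hP₁0 (hP₁ u (by linarith))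
  have hm3 : ∫ u in Ioc ((1 / 4 : ℝ)) (1 / 2), g u ≤ P₁ * (3 / π) * (1 / 2 - (1 / 4 : ℝ)) :=
    hmid _ _ _ (by norm_num) fun u hu ↦ by
      have h1 : (1 : ℝ) / 4 ≤ |u| := by rw [abs_of_pos (by linarith [hu.1])]; exact hu.1.le
      have h2 : |u| ≤ 1 / 2 := by rw [abs_of_pos (by linarith [hu.1])]; exact hu.2
      exact norm_rsKernel_mid_of_le ht hx₀ hδ h1 h2 hP₁0 (hP₁ u h2)
  have hexp : Real.exp (-(π * (1 / 2))) / π ≤ 0.0838 := by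
    have h1 : 3.804 ≤ Real.exp (π * (1 / 2)) := by
      have := Real.quadratic_le_exp_of_nonneg (x := π * (1 / 2)) (by positivity)
      nlinarith
    rw [Real.exp_neg, div_le_iff₀ hπ, inv_eq_one_div, div_le_iff₀ (Real.exp_pos _)]
    nlinarith [mul_le_mul hπ3.le h1 (by norm_num) hπ.le]
  rw [hsplit1, hunion _ _ (by norm_num : (-(1 / 2 : ℝ)) ≤ -(1 / 4)),
    hunion _ _ (by norm_num : (-(1 / 4 : ℝ)) ≤ 1 / 4), hunion _ _ (by norm_num : ((1 / 4 : ℝ)) ≤ 1 / 2)]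
  have e1 : P₁ * (3 / π) * (-(1 / 4) - -(1 / 2 : ℝ)) + P₁ * (25 / 14) * (1 / 4 - -(1 / 4 : ℝ)) +
      P₁ * (3 / π) * (1 / 2 - (1 / 4 : ℝ)) = P₁ * (25 / 28 + 3 / (2 * π)) := by
    field_simp; ring
  have e2 : P₂ * (22 / 9) * (Real.exp (-(π * (1 / 2))) / π) ≤ P₂ * (22 / 9) * 0.0838 :=
    mul_le_mul_of_nonneg_left hexp (by positivity)
  nlinarith

/-- **On `σ = 1`** the power is `‖x‖^{-1} ≤ 4/29` for `|u| ≤ ½` (`‖x‖ ≥ Re x ≥ 7.25`) and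
`≤ 0.1826` for all `u` (`‖x‖ ≥ c/√2 ≥ 7.75/√2`), whence `∫ ‖F_{1+it}‖ ≤ 0.264` for `t = 2πx₀²`,
`x₀ ≥ 8`. [cite: Titchmarsh1986, §4.16] -/
theorem integral_norm_rsKernel_one_le {x₀ c t : ℝ} (ht : t = 2 * π * x₀ ^ 2) (hx₀ : 8 ≤ x₀)
    (hδ : |c - x₀| ≤ 1 / 4) (hd : ∀ n : ℤ, (1 : ℝ) / 4 ≤ |c - n|) :
    ∫ u : ℝ, ‖rsKernel (1 + t * I) (line c u)‖ ≤ 0.264 := by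
  have hπ := Real.pi_pos
  have hπ3 : 3.1415 < π := Real.pi_gt_d4
  obtain ⟨hδ1, hδ2⟩ := abs_le.1 hδ
  have hc : 7.75 ≤ c := by linarith
  have hre : (1 + t * I : ℂ).re = 1 := by simp
  have him : (1 + t * I : ℂ).im = 2 * π * x₀ ^ 2 := by rw [← ht]; simp
  have hpow : ∀ u : ℝ, ‖line c u‖ ^ (-(1 + t * I : ℂ).re) = ‖line c u‖⁻¹ := by
    intro u; rw [hre, Real.rpow_neg (norm_nonneg _), Real.rpow_one]
  have hP₁ : ∀ u : ℝ, |u| ≤ 1 / 2 → ‖line c u‖ ^ (-(1 + t * I : ℂ).re) ≤ 4 / 29 := by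
    intro u hu
    rw [hpow]
    have h1 : (7.25 : ℝ) ≤ ‖line c u‖ := by
      refine le_trans ?_ (Complex.re_le_norm _)
      rw [line_re]; linarith [(abs_le.1 hu).1]
    rw [inv_eq_one_div, div_le_div_iff₀ (by linarith) (by norm_num)]
    linarith
  have hP₂ : ∀ u : ℝ, 1 / 2 < |u| → ‖line c u‖ ^ (-(1 + t * I : ℂ).re) ≤ 0.1826 := by
    intro u _
    rw [hpow]
    have h1 := half_sq_le_sq_norm_line c u
    have h2 : (5.4765 : ℝ) ^ 2 ≤ ‖line c u‖ ^ 2 := by nlinarith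
    have h3 : (5.4765 : ℝ) ≤ ‖line c u‖ := by nlinarith [norm_nonneg (line c u)]
    rw [inv_eq_one_div, div_le_iff₀ (by linarith)]
    nlinarith
  have h := integral_norm_rsKernel_le_of_le him hx₀ hδ hd (by norm_num) (by norm_num) hP₁ hP₂
  have hq : (3 : ℝ) / (2 * π) ≤ 0.4775 := by
    rw [div_le_iff₀ (by positivity)]; nlinarith
  nlinarith

/-- **On `σ = 0`** the power is `1`, whence `∫ ‖F_{it}‖ ≤ 1.781` for `t = 2πx₀²`, `x₀ ≥ 8`.
[cite: Titchmarsh1986, §4.16] -/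
theorem integral_norm_rsKernel_zero_le {x₀ c t : ℝ} (ht : t = 2 * π * x₀ ^ 2) (hx₀ : 8 ≤ x₀)
    (hδ : |c - x₀| ≤ 1 / 4) (hd : ∀ n : ℤ, (1 : ℝ) / 4 ≤ |c - n|) :
    ∫ u : ℝ, ‖rsKernel (t * I) (line c u)‖ ≤ 1.781 := by
  have hπ := Real.pi_pos
  have hπ3 : 3.1415 < π := Real.pi_gt_d4
  have hre : (t * I : ℂ).re = 0 := by simp
  have him : (t * I : ℂ).im = 2 * π * x₀ ^ 2 := by rw [← ht]; simp
  have hpow : ∀ u : ℝ, ‖line c u‖ ^ (-(t * I : ℂ).re) = 1 := by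
    intro u; rw [hre, neg_zero, Real.rpow_zero]
  have h := integral_norm_rsKernel_le_of_le him hx₀ hδ hd (by norm_num : (0 : ℝ) ≤ 1)
    (by norm_num : (0 : ℝ) ≤ 1) (fun u _ ↦ (hpow u).le) (fun u _ ↦ (hpow u).le)
  have hq : (3 : ℝ) / (2 * π) ≤ 0.4775 := by
    rw [div_le_iff₀ (by positivity)]; nlinarith
  nlinarith

/-! ### `|χ(1+it)|` -/

/-- **`|χ(1+it)| ≤ 1.0001 (2π/t)^{1/2}` for `t ≥ 4`**: `|χ(1+it)|² = (2π/t) coth(πt/2)`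
(`|(2π)^{1+it}| = 2π`, `|cos(π(1+it)/2)| = sinh(πt/2)`, `|Γ(1+it)|² = πt/sinh(πt)`), and
`coth(πt/2) ≤ 1.0002` for `t ≥ 4`. [cite: Titchmarsh1986, (4.12.3)] -/
theorem norm_rsChi_one_add_le {t : ℝ} (ht : 4 ≤ t) :
    ‖rsChi (1 + t * I)‖ ≤ 1.0001 * Real.sqrt (2 * π / t) := by
  have hπ := Real.pi_pos
  have ht0 : 0 < t := by linarith
  set s : ℂ := 1 + t * I with hs
  -- the three moduli
  have h2π : ‖(2 * π : ℂ) ^ s‖ = 2 * π := by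
    have : (2 * π : ℂ) = ((2 * π : ℝ) : ℂ) := by push_cast; ring
    rw [this, Complex.norm_cpow_eq_rpow_re_of_pos (by positivity)]
    simp [hs]
  have hcos : Complex.cos (π * s / 2) = -((Real.sinh (π * t / 2) : ℂ) * I) := by
    have e : (π : ℂ) * s / 2 = (π / 2 : ℂ) + ((π * t / 2 : ℝ) : ℂ) * I := by
      rw [hs]; push_cast; ring
    rw [e, Complex.cos_add, Complex.cos_pi_div_two, Complex.sin_pi_div_two, zero_mul, one_mul,
      zero_sub, Complex.sin_mul_I, ← Complex.ofReal_sinh]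
  have hsinh2 : 0 < Real.sinh (π * t / 2) := Real.sinh_pos_iff.2 (by positivity)
  have hsinh : 0 < Real.sinh (π * t) := Real.sinh_pos_iff.2 (by positivity)
  have hncos : ‖Complex.cos (π * s / 2)‖ = Real.sinh (π * t / 2) := by
    rw [hcos, norm_neg, norm_mul, Complex.norm_real, Complex.norm_I, mul_one, Real.norm_eq_abs,
      abs_of_pos hsinh2]
  have hΓsq : ‖Complex.Gamma s‖ ^ 2 = π * t / Real.sinh (π * t) :=
    Literature.Analysis.SpecialFunctions.GammaVert.norm_sq_Gamma_one t ht0.ne'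
  have hΓpos : 0 < ‖Complex.Gamma s‖ := by
    have : 0 < ‖Complex.Gamma s‖ ^ 2 := by rw [hΓsq]; positivity
    nlinarith [norm_nonneg (Complex.Gamma s)]
  -- `‖χ‖ = 2π / (2 ‖Γ‖ sinh(πt/2))`
  have hχ : ‖rsChi s‖ = π / (‖Complex.Gamma s‖ * Real.sinh (π * t / 2)) := by
    rw [rsChi_def, norm_div, h2π, norm_mul, norm_mul, Complex.norm_two, hncos]
    field_simp
  rw [hχ]
  rw [div_le_iff₀ (mul_pos hΓpos hsinh2)]
  have hcosh : Real.sinh (π * t) = 2 * Real.sinh (π * t / 2) * Real.cosh (π * t / 2) := by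
    rw [show π * t = 2 * (π * t / 2) by ring, Real.sinh_two_mul]; ring
  -- `cosh x ≤ 1.0002 sinh x` for `x = πt/2 ≥ 2π ≥ 6`
  have hcs : Real.cosh (π * t / 2) ≤ 1.0002 * Real.sinh (π * t / 2) := by
    rw [Real.cosh_eq, Real.sinh_eq]
    have hπ3 : 3.1415 < π := Real.pi_gt_d4
    have hx : 6 ≤ π * t / 2 := by nlinarith
    have hex : (400 : ℝ) ≤ Real.exp (π * t / 2) := by
      have h1 : Real.exp 6 ≤ Real.exp (π * t / 2) := Real.exp_le_exp.2 hx
      have h2 : (400 : ℝ) ≤ Real.exp 6 := by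
        have he := Real.exp_one_gt_d9
        have e6 : Real.exp 6 = Real.exp 1 ^ 6 := by rw [← Real.exp_nat_mul]; norm_num
        rw [e6]
        have : (2.7182818283 : ℝ) ^ 6 ≤ Real.exp 1 ^ 6 :=
          pow_le_pow_left₀ (by norm_num) he.le 6
        nlinarith
      linarith
    have hexn : Real.exp (-(π * t / 2)) * Real.exp (π * t / 2) = 1 := by
      rw [← Real.exp_add, neg_add_cancel, Real.exp_zero]
    have hexn0 : 0 < Real.exp (-(π * t / 2)) := Real.exp_pos _
    have hsmall : Real.exp (-(π * t / 2)) ≤ 1 / 400 := by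
      nlinarith
    linarith
  have hG2 : ‖Complex.Gamma s‖ ^ 2 * (2 * Real.sinh (π * t / 2) * Real.cosh (π * t / 2)) = π * t := by
    rw [hΓsq, hcosh]; field_simp
  have hcosh0 : 0 < Real.cosh (π * t / 2) := Real.cosh_pos _
  have hsq2 : Real.sqrt (2 * π / t) ^ 2 = 2 * π / t := Real.sq_sqrt (by positivity)
  -- it suffices to compare squares
  have key : π ^ 2 ≤
      (1.0001 * Real.sqrt (2 * π / t) * (‖Complex.Gamma s‖ * Real.sinh (π * t / 2))) ^ 2 := by
    have e : (1.0001 * Real.sqrt (2 * π / t) * (‖Complex.Gamma s‖ * Real.sinh (π * t / 2))) ^ 2 =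
        1.0001 ^ 2 * (2 * π / t) * ‖Complex.Gamma s‖ ^ 2 * Real.sinh (π * t / 2) ^ 2 := by
      rw [mul_pow, mul_pow, mul_pow, hsq2]; ring
    rw [e]
    have e2 : (2 * π / t) * ‖Complex.Gamma s‖ ^ 2 * Real.sinh (π * t / 2) ^ 2 * Real.cosh (π * t / 2) =
        π ^ 2 * Real.sinh (π * t / 2) := by
      have h' : (2 * π / t) * ‖Complex.Gamma s‖ ^ 2 * Real.sinh (π * t / 2) ^ 2 * Real.cosh (π * t / 2)
          = π / t * Real.sinh (π * t / 2) *
            (‖Complex.Gamma s‖ ^ 2 * (2 * Real.sinh (π * t / 2) * Real.cosh (π * t / 2))) := by ring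
      rw [h', hG2]; field_simp
    have h3 : π ^ 2 * Real.cosh (π * t / 2) ≤ 1.0001 ^ 2 * (π ^ 2 * Real.sinh (π * t / 2)) := by
      nlinarith [hcs, sq_nonneg π]
    have h4 : π ^ 2 * Real.cosh (π * t / 2) ≤
        (1.0001 ^ 2 * (2 * π / t) * ‖Complex.Gamma s‖ ^ 2 * Real.sinh (π * t / 2) ^ 2) *
          Real.cosh (π * t / 2) := by
      rw [show (1.0001 : ℝ) ^ 2 * (2 * π / t) * ‖Complex.Gamma s‖ ^ 2 * Real.sinh (π * t / 2) ^ 2 *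
          Real.cosh (π * t / 2) = 1.0001 ^ 2 * ((2 * π / t) * ‖Complex.Gamma s‖ ^ 2 *
          Real.sinh (π * t / 2) ^ 2 * Real.cosh (π * t / 2)) by ring, e2]
      exact h3
    exact le_of_mul_le_mul_right h4 hcosh0
  have hpos : 0 ≤ 1.0001 * Real.sqrt (2 * π / t) * (‖Complex.Gamma s‖ * Real.sinh (π * t / 2)) := by
    positivity
  exact (pow_le_pow_iff_left₀ hπ.le hpos (by norm_num : (2 : ℕ) ≠ 0)).1 key

/-! ### `|ζ(1+it)| ≤ ½ log t + 1.85` for `t ≥ 128π` -/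

/-- **An explicit bound on the line `σ = 1` from the Riemann–Siegel integral formula**: for
`t ≥ 128π`, `|ζ(1+it)| ≤ ½ log t + 1.85`.  Proof: `ζ(s) = 𝓡(s) + χ(s) conj 𝓡(it)` at `s = 1+it`
(`Literature.NumberTheory.LFunctions.SiegelIntegral.riemannZeta_eq_riemannAux_add`),
`𝓡(w) = Σ_{n≤N} n^{-w} + J_c(w)` with `N = ⌊√(t/2π)⌋` for `w = 1+it` and `w = it`
(`Literature.NumberTheory.LFunctions.SiegelIntegral.riemannAux_eq_sum_add_rsLineIntegral`),
`|Σ n^{-1-it}| ≤ H_N ≤ 1 + log N`, `|Σ n^{-it}| ≤ N ≤ √(t/2π)`, the saddle-point bounds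
`|J_c(1+it)| ≤ √2 · 0.264`, `|J_c(it)| ≤ √2 · 1.781`, and `|χ(1+it)| ≤ 1.0001 √(2π/t)`; with
`log(2π) ≥ 1.7195` this is `≤ ½ log t + 1.83 ≤ ½ log t + 1.85`.  (Patel: `½ log t + 1.93` for `t ≥ 47`, by the same
formula with the Riemann–Siegel remainder bounds of Arias de Reyna; Hoo–Teo: `½ log t + 0.6633`.)
[cite: Patel2022, Thm 1.1 and (4.1)] -/
theorem norm_riemannZeta_one_add_le_half_log {t : ℝ} (ht : 128 * π ≤ t) :
    ‖riemannZeta (1 + t * I)‖ ≤ 1 / 2 * Real.log t + 1.85 := by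
  have hπ := Real.pi_pos
  have hπ3 : 3.1415 < π := Real.pi_gt_d4
  have ht0 : 0 < t := by nlinarith
  -- `x₀ = √(t/2π) ≥ 8`, `t = 2π x₀²`
  set x₀ : ℝ := Real.sqrt (t / (2 * π)) with hx₀def
  have hx₀sq : x₀ ^ 2 = t / (2 * π) := by
    rw [hx₀def]; exact Real.sq_sqrt (div_nonneg ht0.le (by positivity))
  have ht' : t = 2 * π * x₀ ^ 2 := by rw [hx₀sq]; field_simp
  have hx₀ : 8 ≤ x₀ := by
    rw [hx₀def, Real.le_sqrt (by norm_num) (div_nonneg ht0.le (by positivity))]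
    rw [le_div_iff₀ (by positivity)]; nlinarith
  have hx₀0 : 0 < x₀ := by linarith
  set N : ℕ := ⌊x₀⌋₊ with hNdef
  set c : ℝ := max ((N : ℝ) + 1 / 4) (min x₀ (N + 3 / 4)) with hcdef
  obtain ⟨hN8, hc1, hc2, hδ, hd, hNle⟩ := clamp_props hx₀ hNdef hcdef
  obtain ⟨s₀, hs₀def⟩ : ∃ s₀ : ℂ, s₀ = t * I := ⟨_, rfl⟩
  set s : ℂ := 1 + t * I with hsdef
  have hs1 : s ≠ 1 := fun h ↦ by
    have := congrArg Complex.im h; simp [hsdef] at this; linarith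
  -- the formula and the two residue shifts
  have hζ := riemannZeta_eq_riemannAux_add (s := s) (by norm_num [hsdef]) (by norm_num [hsdef]) hs1
  have hK : riemannAuxConj s = conj (riemannAux s₀) := by
    rw [riemannAuxConj, hs₀def]
    congr 2
    apply Complex.ext <;> simp [hsdef]
  have h2 := riemannAux_eq_sum_add_rsLineIntegral s (N := N) (by omega) (c := c) (by linarith)
    (by linarith)
  have h2₀ := riemannAux_eq_sum_add_rsLineIntegral s₀ (N := N) (by omega) (c := c) (by linarith)
    (by linarith)
  -- the sums
  have hN0 : (0 : ℝ) < N := by exact_mod_cast (by omega : 0 < N)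
  have hsum : ‖∑ n ∈ Finset.Icc 1 N, ((n : ℂ)) ^ (-s)‖ ≤ 1 + Real.log N := by
    calc ‖∑ n ∈ Finset.Icc 1 N, ((n : ℂ)) ^ (-s)‖ ≤ ∑ n ∈ Finset.Icc 1 N, ‖((n : ℂ)) ^ (-s)‖ :=
          norm_sum_le _ _
      _ = ∑ n ∈ Finset.Icc 1 N, ((n : ℝ))⁻¹ := by
          refine Finset.sum_congr rfl fun n hn ↦ ?_
          rw [Complex.norm_natCast_cpow_of_pos (by simp at hn; omega)]
          have : (-s).re = -1 := by simp [hsdef]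
          rw [this, Real.rpow_neg_one]
      _ = (harmonic N : ℝ) := by
          rw [harmonic_eq_sum_Icc]; push_cast
          refine Finset.sum_congr rfl fun n _ ↦ by simp
      _ ≤ 1 + Real.log N := harmonic_le_one_add_log N
  have hsum₀ : ‖∑ n ∈ Finset.Icc 1 N, ((n : ℂ)) ^ (-s₀)‖ ≤ N := by
    calc ‖∑ n ∈ Finset.Icc 1 N, ((n : ℂ)) ^ (-s₀)‖ ≤ ∑ n ∈ Finset.Icc 1 N, ‖((n : ℂ)) ^ (-s₀)‖ :=
          norm_sum_le _ _
      _ = ∑ n ∈ Finset.Icc 1 N, (1 : ℝ) := by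
          refine Finset.sum_congr rfl fun n hn ↦ ?_
          rw [Complex.norm_natCast_cpow_of_pos (by simp at hn; omega)]
          have : (-s₀).re = 0 := by simp [hs₀def]
          rw [this, Real.rpow_zero]
      _ = N := by simp
  -- the line integrals
  have hn2 : ‖(1 : ℂ) + I‖ = Real.sqrt 2 := by
    have := Complex.norm_add_mul_I 1 1
    simp only [ofReal_one, one_mul] at this
    rw [this]; norm_num
  have hJ : ‖rsLineIntegral c s‖ ≤ Real.sqrt 2 * 0.264 := by
    rw [rsLineIntegral, norm_mul, norm_neg, hn2]
    refine mul_le_mul_of_nonneg_left ?_ (Real.sqrt_nonneg _)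
    refine (norm_integral_le_integral_norm _).trans ?_
    exact integral_norm_rsKernel_one_le ht' hx₀ hδ hd
  have hJ₀ : ‖rsLineIntegral c s₀‖ ≤ Real.sqrt 2 * 1.781 := by
    rw [rsLineIntegral, norm_mul, norm_neg, hn2, hs₀def]
    refine mul_le_mul_of_nonneg_left ?_ (Real.sqrt_nonneg _)
    refine (norm_integral_le_integral_norm _).trans ?_
    exact integral_norm_rsKernel_zero_le ht' hx₀ hδ hd
  -- `χ`
  have hχ : ‖rsChi s‖ ≤ 1.0001 * Real.sqrt (2 * π / t) := norm_rsChi_one_add_le (by nlinarith)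
  have hsqrt : Real.sqrt (2 * π / t) = x₀⁻¹ := by
    rw [ht', show 2 * π / (2 * π * x₀ ^ 2) = (x₀ ^ 2)⁻¹ by field_simp, Real.sqrt_inv,
      Real.sqrt_sq hx₀0.le]
  rw [hsqrt] at hχ
  -- assemble
  have hR : ‖riemannAux s‖ ≤ 1 + Real.log N + Real.sqrt 2 * 0.264 := by
    rw [h2]; exact (norm_add_le _ _).trans (add_le_add hsum hJ)
  have hR₀ : ‖riemannAux s₀‖ ≤ N + Real.sqrt 2 * 1.781 := by
    rw [h2₀]; exact (norm_add_le _ _).trans (add_le_add hsum₀ hJ₀)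
  have hsqrt2 : Real.sqrt 2 ≤ 1.4143 := by
    rw [Real.sqrt_le_left (by norm_num)]; norm_num
  have hlogN : Real.log N ≤ Real.log x₀ := Real.log_le_log hN0 hNle
  -- `log x₀ = ½ log t − ½ log(2π)` and `log(2π) ≥ 1.7195`
  have hlogx₀ : Real.log x₀ ≤ 1 / 2 * Real.log t - 0.8597 := by
    have e : Real.log x₀ = 1 / 2 * (Real.log t - Real.log (2 * π)) := by
      rw [hx₀def, Real.log_sqrt (div_nonneg ht0.le (by positivity)),
        Real.log_div ht0.ne' (by positivity)]
      ring
    have hl2 := Real.log_two_gt_d9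
    have hl3 : (1.0264 : ℝ) ≤ Real.log 3 := by
      have h1 : Real.log 3 = Real.log 2 + Real.log (3 / 2) := by
        rw [← Real.log_mul (by norm_num) (by norm_num)]; norm_num
      have h2 : 1 - (3 / 2 : ℝ)⁻¹ ≤ Real.log (3 / 2) := Real.one_sub_inv_le_log_of_pos (by norm_num)
      rw [h1]; norm_num at h2 ⊢; linarith
    have hlπ : Real.log 3 ≤ Real.log π := Real.log_le_log (by norm_num) Real.pi_gt_three.le
    have hl2π : (1.7195 : ℝ) ≤ Real.log (2 * π) := by
      rw [Real.log_mul (by norm_num) hπ.ne']; linarith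
    rw [e]; linarith
  calc ‖riemannZeta (1 + t * I)‖ = ‖riemannAux s + rsChi s * riemannAuxConj s‖ := by rw [← hζ]
    _ ≤ ‖riemannAux s‖ + ‖rsChi s‖ * ‖riemannAuxConj s‖ := by
        refine (norm_add_le _ _).trans ?_; rw [norm_mul]
    _ = ‖riemannAux s‖ + ‖rsChi s‖ * ‖riemannAux s₀‖ := by rw [hK, Complex.norm_conj]
    _ ≤ (1 + Real.log N + Real.sqrt 2 * 0.264) + 1.0001 * x₀⁻¹ * (N + Real.sqrt 2 * 1.781) := by
        gcongr
    _ ≤ 1 / 2 * Real.log t + 1.85 := by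
        have hinv : x₀⁻¹ * N ≤ 1 := by rw [inv_mul_le_iff₀ hx₀0]; linarith
        have hinv2 : x₀⁻¹ ≤ 1 / 8 := by
          rw [inv_eq_one_div]; exact one_div_le_one_div_of_le (by norm_num) hx₀
        have hinv0 : 0 < x₀⁻¹ := inv_pos.2 hx₀0
        nlinarith [hsqrt2, hlogN, hlogx₀, Real.sqrt_nonneg 2]

end SiegelIntegral

end Literature.NumberTheory.LFunctions

end
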